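import Summits.CriticalPhenomena.SAWScalingLimit.Theorems.SAWTensorRGRestrictionOfLimitRadoModel
import HarnessLib

/-!
# Radó squeezes, part 5: the collar path of the model half-disc

Support file (`--supports stmt-CriticalPhenomena-0773`, towards the registered stub `stub_radoSqueezeFamily`,
geometry F′ of the line `birth` for the crux `RestrictionOfLimit`). Elementary plane geometry only.

The boundary of the kept collar of the model half-disc at level `η ∈ (0, 1/4]` (part 1) is traversed by the
COLLAR PATH `pPar η : [0, 1] → closed half-disc`: from `1` up the unit circle to height `η` (parameters
`u ∈ [0, η]`), along the chord `{im = η}` from right to left (`u ∈ [η, 1 - η]`), down the unit circle to `-1`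
(`u ∈ [1 - η, 1]`). In one formula `pPar η u = √(1 - m²) L + i m` with height `m = min η (min u (1 - u))` and
horizontal position factor `L = max (-1) (min 1 (1 - 2(u - η)/(1 - 2η)))`. We prove: continuity, end-points
`1`, `-1`, injectivity on `[0, 1]`, values in the closed half-disc at height `≤ η`, the dichotomy "on the open
chord at height `η` or on the unit circle at positive height" for `u ∈ (0, 1)`, and the uniform distance bound
`‖pPar η u - bPar u‖ ≤ 6η` to the base path.

Axioms `propext`, `Classical.choice`, `Quot.sound`.
-/

noncomputable section

open Set Filter Topology Metric Complex
open Literature.Probability.RandomPlanarGeometry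

namespace Summit.CriticalPhenomena.SAWScalingLimit.Theorems.RestrictionOfLimit.Birth

/-! ### The height and the horizontal factor -/

/-- Height profile of the collar path: `min η (min u (1 - u))`. [folklore] -/
def pM (η u : ℝ) : ℝ := min η (min u (1 - u))

/-- Horizontal factor of the collar path: `max (-1) (min 1 (1 - 2(u - η)/(1 - 2η)))`. [folklore] -/
def pL (η u : ℝ) : ℝ := max (-1) (min 1 (1 - 2 * (u - η) / (1 - 2 * η)))

/-- The **collar path** of the model half-disc at level `η`. [folklore] -/
def pPar (η u : ℝ) : ℂ := ((Real.sqrt (1 - pM η u ^ 2) * pL η u : ℝ) : ℂ) + ((pM η u : ℝ) : ℂ) * I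

/-- The height profile is continuous. [folklore] -/
theorem continuous_pM (η : ℝ) : Continuous (pM η) :=
  continuous_const.min (continuous_id.min (continuous_const.sub continuous_id))

/-- The horizontal factor is continuous. [folklore] -/
theorem continuous_pL (η : ℝ) : Continuous (pL η) := by
  unfold pL
  exact continuous_const.max (continuous_const.min (by fun_prop))

/-- The collar path is continuous. [folklore] -/
theorem continuous_pPar (η : ℝ) : Continuous (pPar η) := by
  unfold pPar
  have h1 := continuous_pM η
  have h2 := continuous_pL η
  fun_prop

/-- Real and imaginary parts of the collar path. [folklore] -/
theorem pPar_re_im (η u : ℝ) :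
    (pPar η u).re = Real.sqrt (1 - pM η u ^ 2) * pL η u ∧ (pPar η u).im = pM η u := by
  constructor <;> simp [pPar]

/-- Bounds on the height profile on `[0, 1]`. [folklore] -/
theorem pM_bounds {η u : ℝ} (hη : 0 ≤ η) (hu : u ∈ Icc (0 : ℝ) 1) : 0 ≤ pM η u ∧ pM η u ≤ η :=
  ⟨le_min hη (le_min hu.1 (by linarith [hu.2])), min_le_left _ _⟩

/-- The height profile is positive on `(0, 1)`. [folklore] -/
theorem pM_pos {η u : ℝ} (hη : 0 < η) (hu : u ∈ Ioo (0 : ℝ) 1) : 0 < pM η u :=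
  lt_min hη (lt_min hu.1 (by linarith [hu.2]))

/-- The three regimes of the height profile. [folklore] -/
theorem pM_eq {η u : ℝ} (hη : η ≤ 1 / 4) :
    (u ≤ η → pM η u = u) ∧ (η ≤ u → u ≤ 1 - η → pM η u = η) ∧ (1 - η ≤ u → pM η u = 1 - u) := by
  refine ⟨fun h ↦ ?_, fun h h' ↦ ?_, fun h ↦ ?_⟩
  · rw [pM, min_eq_right_iff.2, min_eq_left (by linarith)]
    rw [min_eq_left (by linarith)]; exact h
  · rw [pM, min_eq_left (le_min h (by linarith))]
  · rw [pM, min_eq_right_iff.2, min_eq_right (by linarith)]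
    rw [min_eq_right (by linarith)]; linarith

/-- Bounds on the horizontal factor. [folklore] -/
theorem pL_bounds (η u : ℝ) : -1 ≤ pL η u ∧ pL η u ≤ 1 :=
  ⟨le_max_left _ _, max_le (by norm_num) (min_le_left _ _)⟩

/-- The three regimes of the horizontal factor, and the converse implications. [folklore] -/
theorem pL_eq {η u : ℝ} (hη : η ≤ 1 / 4) :
    (u ≤ η → pL η u = 1) ∧ (η ≤ u → u ≤ 1 - η → pL η u = 1 - 2 * (u - η) / (1 - 2 * η)) ∧
      (1 - η ≤ u → pL η u = -1) ∧ (pL η u = 1 → u ≤ η) ∧ (pL η u = -1 → 1 - η ≤ u) := by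
  have hd : 0 < 1 - 2 * η := by linarith
  have key : ∀ v : ℝ, 1 - 2 * (v - η) / (1 - 2 * η) = (1 - 2 * v) / (1 - 2 * η) := fun v ↦ by
    field_simp; ring
  refine ⟨fun h ↦ ?_, fun h h' ↦ ?_, fun h ↦ ?_, fun h ↦ ?_, fun h ↦ ?_⟩
  · rw [pL, key, min_eq_left ((one_le_div hd).2 (by linarith)), max_eq_right (by norm_num)]
  · rw [pL, min_eq_right, max_eq_right]
    · rw [key, le_div_iff₀ hd]; linarith
    · rw [key, div_le_one hd]; linarith
  · rw [pL, max_eq_left]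
    refine (min_le_right _ _).trans ?_
    rw [key, div_le_iff₀ hd]; linarith
  · by_contra hlt
    rw [not_le] at hlt
    have : pL η u < 1 := by
      rw [pL]
      refine max_lt (by norm_num) (lt_of_le_of_lt (min_le_right _ _) ?_)
      rw [key, div_lt_one hd]; linarith
    linarith
  · by_contra hlt
    rw [not_le] at hlt
    have : -1 < pL η u := by
      rw [pL]
      refine lt_max_of_lt_right (lt_min (by norm_num) ?_)
      rw [key, lt_div_iff₀ hd]; linarith
    linarith

/-! ### End-points, values, injectivity -/

/-- End-points of the collar path: `pPar η 0 = 1`, `pPar η 1 = -1`. [folklore] -/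
theorem pPar_zero_one {η : ℝ} (hη0 : 0 ≤ η) (hη : η ≤ 1 / 4) : pPar η 0 = 1 ∧ pPar η 1 = -1 := by
  have hM0 : pM η 0 = 0 := (pM_eq hη (u := 0)).1 hη0
  have hM1 : pM η 1 = 0 := by have := (pM_eq hη (u := 1)).2.2 (by linarith); linarith
  have hL0 : pL η 0 = 1 := (pL_eq hη).1 hη0
  have hL1 : pL η 1 = -1 := (pL_eq hη).2.2.1 (by linarith)
  constructor
  · apply Complex.ext <;> simp [pPar_re_im, hM0, hL0]
  · apply Complex.ext <;> simp [pPar_re_im, hM1, hL1]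

/-- **Values of the collar path**: in the closed unit disc, at height between `0` and `η`; the squared norm is
`(1 - m²) L² + m²`. [folklore] -/
theorem norm_pPar {η u : ℝ} (hη0 : 0 ≤ η) (hη : η ≤ 1 / 4) (hu : u ∈ Icc (0 : ℝ) 1) :
    ‖pPar η u‖ ^ 2 = (1 - pM η u ^ 2) * pL η u ^ 2 + pM η u ^ 2 ∧ ‖pPar η u‖ ≤ 1 ∧
      0 ≤ (pPar η u).im ∧ (pPar η u).im ≤ η := by
  obtain ⟨hm0, hmη⟩ := pM_bounds hη0 hu
  obtain ⟨hL1, hL2⟩ := pL_bounds η u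
  have hm1 : pM η u ^ 2 ≤ 1 := by nlinarith
  have hsq : ‖pPar η u‖ ^ 2 = (1 - pM η u ^ 2) * pL η u ^ 2 + pM η u ^ 2 := by
    rw [pPar, ← Complex.normSq_eq_norm_sq, normSq_add_mul_I, mul_pow, Real.sq_sqrt (by linarith)]
  have hL : pL η u ^ 2 ≤ 1 := by nlinarith
  refine ⟨hsq, ?_, by rw [(pPar_re_im η u).2]; exact hm0, by rw [(pPar_re_im η u).2]; exact hmη⟩
  have : ‖pPar η u‖ ^ 2 ≤ 1 := by rw [hsq]; nlinarith
  nlinarith [norm_nonneg (pPar η u)]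

/-- **Dichotomy for interior parameters**: for `u ∈ (0, 1)` the point `pPar η u` lies either on the open chord
`{‖z‖ < 1, im z = η}` or on the unit circle at a positive height `≤ η`. [folklore] -/
theorem pPar_dichotomy {η u : ℝ} (hη0 : 0 < η) (hη : η ≤ 1 / 4) (hu : u ∈ Ioo (0 : ℝ) 1) :
    (‖pPar η u‖ < 1 ∧ (pPar η u).im = η) ∨ (‖pPar η u‖ = 1 ∧ 0 < (pPar η u).im ∧ (pPar η u).im ≤ η) := by
  have hu' : u ∈ Icc (0 : ℝ) 1 := ⟨hu.1.le, hu.2.le⟩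
  obtain ⟨hsq, hle, -, hη'⟩ := norm_pPar hη0.le hη hu'
  have hmpos : 0 < (pPar η u).im := by rw [(pPar_re_im η u).2]; exact pM_pos hη0 hu
  obtain ⟨hL1, hL2⟩ := pL_bounds η u
  by_cases hL : pL η u ^ 2 = 1
  · right
    refine ⟨?_, hmpos, hη'⟩
    have : ‖pPar η u‖ ^ 2 = 1 := by rw [hsq, hL]; ring
    nlinarith [norm_nonneg (pPar η u)]
  · left
    have hL' : pL η u ^ 2 < 1 := lt_of_le_of_ne (by nlinarith) hL
    have hne1 : pL η u ≠ 1 := fun h ↦ hL (by rw [h]; norm_num)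
    have hne2 : pL η u ≠ -1 := fun h ↦ hL (by rw [h]; norm_num)
    obtain ⟨h1, h2, h3, -, -⟩ := pL_eq hη (u := u)
    have hηu : η < u := by by_contra h; exact hne1 (h1 (not_lt.1 h))
    have huη : u < 1 - η := by by_contra h; exact hne2 (h3 (not_lt.1 h))
    have hm : pM η u = η := (pM_eq hη (u := u)).2.1 hηu.le huη.le
    obtain ⟨hm0, -⟩ := pM_bounds hη0.le hu'
    refine ⟨?_, by rw [(pPar_re_im η u).2, hm]⟩
    have hm1 : pM η u ^ 2 < 1 := by rw [hm]; nlinarith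
    have : ‖pPar η u‖ ^ 2 < 1 := by rw [hsq]; nlinarith
    nlinarith [norm_nonneg (pPar η u)]

/-- **The collar path is injective on `[0, 1]`.** [folklore] -/
theorem pPar_injOn {η : ℝ} (hη0 : 0 < η) (hη : η ≤ 1 / 4) : InjOn (pPar η) (Icc 0 1) := by
  intro u hu v hv h
  have him : pM η u = pM η v := by
    have := congrArg Complex.im h
    rwa [(pPar_re_im η u).2, (pPar_re_im η v).2] at this
  have hre : pL η u = pL η v := by
    have h' := congrArg Complex.re h
    rw [(pPar_re_im η u).1, (pPar_re_im η v).1, him] at h'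
    obtain ⟨hm0, hmη⟩ := pM_bounds hη0.le hv
    have hpos : 0 < Real.sqrt (1 - pM η v ^ 2) := Real.sqrt_pos.2 (by nlinarith)
    exact mul_left_cancel₀ hpos.ne' h'
  obtain ⟨hu1, hu2, hu3, hu4, hu5⟩ := pL_eq hη (u := u)
  obtain ⟨hv1, hv2, hv3, hv4, hv5⟩ := pL_eq hη (u := v)
  by_cases hL1 : pL η u = 1
  · have hu' : u ≤ η := hu4 hL1
    have hv' : v ≤ η := hv4 (hre ▸ hL1)
    rwa [(pM_eq hη (u := u)).1 hu', (pM_eq hη (u := v)).1 hv'] at him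
  by_cases hL2 : pL η u = -1
  · have hu' : 1 - η ≤ u := hu5 hL2
    have hv' : 1 - η ≤ v := hv5 (hre ▸ hL2)
    rw [(pM_eq hη (u := u)).2.2 hu', (pM_eq hη (u := v)).2.2 hv'] at him
    linarith
  · -- both in the middle regime, where `pL` is strictly decreasing
    have hηu : η < u := by by_contra h'; exact hL1 (hu1 (not_lt.1 h'))
    have huη : u < 1 - η := by by_contra h'; exact hL2 (hu3 (not_lt.1 h'))
    have hηv : η < v := by by_contra h'; exact hL1 (hre ▸ hv1 (not_lt.1 h'))
    have hvη : v < 1 - η := by by_contra h'; exact hL2 (hre ▸ hv3 (not_lt.1 h'))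
    rw [hu2 hηu.le huη.le, hv2 hηv.le hvη.le] at hre
    have hd : 0 < 1 - 2 * η := by linarith
    field_simp at hre
    nlinarith

/-- The collar path avoids `±1` on `(0, 1)`. [folklore] -/
theorem pPar_ne_one {η u : ℝ} (hη0 : 0 < η) (hu : u ∈ Ioo (0 : ℝ) 1) : pPar η u ≠ 1 ∧ pPar η u ≠ -1 := by
  have hmpos : 0 < (pPar η u).im := by rw [(pPar_re_im η u).2]; exact pM_pos hη0 hu
  constructor <;> intro h <;> rw [h] at hmpos <;> simp at hmpos

/-! ### Distance to the base path -/

/-- **The collar path is uniformly `6η`-close to the base path** on `[0, 1]`. [folklore] -/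
theorem dist_pPar_bPar {η u : ℝ} (hη0 : 0 < η) (hη : η ≤ 1 / 4) (hu : u ∈ Icc (0 : ℝ) 1) :
    ‖pPar η u - bPar u‖ ≤ 6 * η := by
  obtain ⟨hm0, hmη⟩ := pM_bounds hη0.le hu
  obtain ⟨hL1, hL2⟩ := pL_bounds η u
  set m := pM η u with hm
  set L := pL η u with hL
  have hm1 : m ^ 2 ≤ 1 := by nlinarith
  -- the horizontal factor is `4η`-close to `1 - 2u`
  have hLu : |L - (1 - 2 * u)| ≤ 4 * η := by
    obtain ⟨h1, h2, h3, -, -⟩ := pL_eq hη (u := u)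
    rw [abs_le]
    rcases le_or_gt u η with hu1 | hu1
    · rw [hL, h1 hu1]; constructor <;> linarith [hu.1]
    rcases le_or_gt u (1 - η) with hu2 | hu2
    · rw [hL, h2 hu1.le hu2]
      have hd : 0 < 1 - 2 * η := by linarith
      have : 1 - 2 * (u - η) / (1 - 2 * η) - (1 - 2 * u) = 2 * η * (1 - 2 * u) / (1 - 2 * η) := by
        field_simp; ring
      rw [this]
      have hb : |2 * η * (1 - 2 * u) / (1 - 2 * η)| ≤ 4 * η := by
        rw [abs_div, abs_of_pos hd, div_le_iff₀ hd, abs_mul, abs_of_pos (by linarith : (0 : ℝ) < 2 * η)]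
        have : |1 - 2 * u| ≤ 1 := by rw [abs_le]; constructor <;> linarith [hu.1, hu.2]
        nlinarith
      exact abs_le.1 hb
    · rw [hL, h3 hu2.le]; constructor <;> linarith [hu.2]
  -- the square-root factor is `η²`-close to `1`
  have hsqrt : 1 - m ^ 2 ≤ Real.sqrt (1 - m ^ 2) ∧ Real.sqrt (1 - m ^ 2) ≤ 1 := by
    constructor
    · have h0 : 0 ≤ 1 - m ^ 2 := by linarith
      calc 1 - m ^ 2 = Real.sqrt (1 - m ^ 2) * Real.sqrt (1 - m ^ 2) := (Real.mul_self_sqrt h0).symm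
        _ ≤ Real.sqrt (1 - m ^ 2) * 1 :=
            mul_le_mul_of_nonneg_left (Real.sqrt_le_one.mpr (by linarith [sq_nonneg m])) (Real.sqrt_nonneg _)
        _ = Real.sqrt (1 - m ^ 2) := mul_one _
    · exact Real.sqrt_le_one.mpr (by linarith [sq_nonneg m])
  have hre : |(pPar η u - bPar u).re| ≤ 5 * η := by
    rw [sub_re, (pPar_re_im η u).1, (bPar_re_im u).1]
    have : Real.sqrt (1 - m ^ 2) * L - (1 - 2 * u) = (Real.sqrt (1 - m ^ 2) - 1) * L + (L - (1 - 2 * u)) := by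
      ring
    rw [← hm, ← hL, this]
    calc |(Real.sqrt (1 - m ^ 2) - 1) * L + (L - (1 - 2 * u))|
        ≤ |(Real.sqrt (1 - m ^ 2) - 1) * L| + |L - (1 - 2 * u)| := abs_add_le _ _
      _ ≤ m ^ 2 * 1 + 4 * η := by
          gcongr
          rw [abs_mul]
          exact mul_le_mul (by rw [abs_le]; constructor <;> linarith [hsqrt.1, hsqrt.2]) (abs_le.2 ⟨hL1, hL2⟩)
            (abs_nonneg _) (sq_nonneg _)
      _ ≤ 5 * η := by nlinarith
  have him : |(pPar η u - bPar u).im| ≤ η := by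
    rw [sub_im, (pPar_re_im η u).2, (bPar_re_im u).2, sub_zero, abs_of_nonneg hm0]
    exact hmη
  calc ‖pPar η u - bPar u‖ ≤ |(pPar η u - bPar u).re| + |(pPar η u - bPar u).im| :=
        Complex.norm_le_abs_re_add_abs_im _
    _ ≤ 5 * η + η := add_le_add hre him
    _ = 6 * η := by ring

/-- **Registered helper stub `stub_radoModelPath`** (towards `stub_radoSqueezeFamily`, line `birth`): the collar
path is injective on `[0, 1]` and `6η`-close to the base path, in closed form. [folklore] -/
theorem stub_radoModelPath :
    ∀ η : ℝ, 0 < η → η ≤ 1 / 4 →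
      Set.InjOn (Summit.CriticalPhenomena.SAWScalingLimit.Theorems.RestrictionOfLimit.Birth.pPar η) (Set.Icc 0 1) ∧
        ∀ u ∈ Set.Icc (0 : ℝ) 1,
          ‖Summit.CriticalPhenomena.SAWScalingLimit.Theorems.RestrictionOfLimit.Birth.pPar η u -
              Summit.CriticalPhenomena.SAWScalingLimit.Theorems.RestrictionOfLimit.Birth.bPar u‖ ≤ 6 * η :=
  fun _ hη0 hη ↦ ⟨pPar_injOn hη0 hη, fun _ hu ↦ dist_pPar_bPar hη0 hη hu⟩

end Summit.CriticalPhenomena.SAWScalingLimit.Theorems.RestrictionOfLimit.Birth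

end
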